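import Mathlib
import Literature.NumberTheory.Automorphic.TwistedQuotientPullbackCalculus
import HarnessLib

/-!
# Transfer of polynomial growth along a cover by translates: the radial pull-back of an
# invariant form

Topic `NumberTheory/Automorphic`; namespace `Literature.NumberTheory.Automorphic`, grouping
sub-namespace `TwistedQuotient`.  Theorems only.  This is the bookkeeping step of Borel's
regularisation of invariant forms on an arithmetic quotient [Borel1983Regularization, §3.5], made
abstract: a group `Λ` (rational points) acts on a real normed space `W` by `act : Λ →* (W →L[ℝ] W)`
preserving an open set `X` (the symmetric cone); a group `Γ` (an arithmetic subgroup) maps to `Λ` by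
`ι` and acts on the coefficients `V` by `ρ`; a GAUGE `E ≥ 1` on `W` is distorted by at most a constant
factor by each `act g`; "reduced sets" `R₀ ⊆ R'`, `R₁ ⊆ R'` play the role of the images of Siegel
sets, with `R₀` closed under the inverse scalings `x ↦ r⁻¹ x`; the translates `(ι γ · t) · R₀`,
`γ ∈ Γ`, `t ∈ T` finite, COVER `X`, and for each `t ∈ T` only FINITELY many `γ` move `t · R'` onto
`g⁻¹ · R'` (the Siegel property); finally `p : X → X` is a differentiable retraction along rays
(`p x = r x`, `r > 0`) with derivatives of polynomial growth in `E` and `E(p x) ≤ C E(x)ᵏ`.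

* `growth_pullback` — if the `q`-form `β₀` is differentiable on `X`, `Γ`-invariant for the twisted
  pull-back `actAlt ρ (act ∘ ι)`, and has `C¹` bounds `≤ C E^k` on the fundamental set
  `F' = {w ∈ X : some t⁻¹ · w ∈ R₀, t ∈ T}`, then its radial pull-back `p^* β₀` has `C¹` bounds
  `≤ C' E^{k'}` on `{y ∈ X : g · y ∈ R₁}`: the cover applied to `p y` produces `γ, t` with
  `(ι γ t)⁻¹ · y ∈ R₀`, so `γ` lies in a finite set on which the operator norms of `ρ γ`, `act (ι γ)⁻¹`
  and the distortion of `E` are bounded; invariance moves `p y` into `F'`.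

## References

* A. Borel, *Regularization theorems in Lie algebra cohomology. Applications*, Duke Math. J. 50
  (1983), §3.5. [Borel1983Regularization]
* A. Borel, *Introduction aux groupes arithmétiques*, Hermann (1969), §13, §15 (fundamental sets and
  the Siegel property). [Borel1969]
-/

noncomputable section

open Set Filter
open scoped Topology

namespace Literature.NumberTheory.Automorphic

namespace TwistedQuotient

variable {Λ : Type} [Group Λ] {Γ : Type} [Group Γ]
  {V : Type} [NormedAddCommGroup V] [NormedSpace ℂ V] [FiniteDimensional ℂ V]
  {W : Type} [NormedAddCommGroup W] [NormedSpace ℝ W]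

/-- **Polynomial `C¹` growth of the radial pull-back of an invariant form on the translates of a
reduced set** (abstract form of [Borel1983Regularization, §3.5]; see the module docstring for the
setting).  Output: `C, k` with `‖p^*β₀ (y)‖, ‖D(p^*β₀)(y)‖ ≤ C E(y)ᵏ` whenever `y ∈ X` and
`g · y ∈ R₁`. [cite: Borel1983Regularization, §3.5] -/
theorem growth_pullback (act : Λ →* (W →L[ℝ] W)) (ι : Γ →* Λ) (ρ : Representation ℂ Γ V)
    {X : Set W} (hXo : IsOpen X) (hX : ∀ g : Λ, MapsTo (act g) X X)
    (E : W → ℝ) (hE1 : ∀ x, 1 ≤ E x)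
    (hEact : ∀ g : Λ, ∃ d : ℝ, 0 ≤ d ∧ ∀ x, E (act g x) ≤ d * E x)
    {R₀ R₁ R' : Set W} (h₀ : R₀ ⊆ R') (h₁ : R₁ ⊆ R')
    (hR₀ : ∀ r : ℝ, 0 < r → ∀ x, r • x ∈ R₀ → x ∈ R₀)
    (T : Finset Λ) (hcov : ∀ H ∈ X, ∃ (γ : Γ) (t : Λ), t ∈ T ∧ act (ι γ * t)⁻¹ H ∈ R₀)
    (g : Λ) (hfin : ∀ t ∈ T, Set.Finite {γ : Γ | ∃ H ∈ X, act (ι γ * t)⁻¹ H ∈ R' ∧ act g H ∈ R'})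
    (p : W → W) (hpX : ∀ x ∈ X, p x ∈ X) (hpr : ∀ x ∈ X, ∃ r : ℝ, 0 < r ∧ p x = r • x)
    (hpd : DifferentiableOn ℝ p X) (hpd2 : DifferentiableOn ℝ (fun x => fderiv ℝ p x) X)
    {Cp : ℝ} {kp : ℕ} (hDp : ∀ y ∈ X, ‖fderiv ℝ p y‖ ≤ Cp * E y ^ kp ∧
      ‖fderiv ℝ (fderiv ℝ p) y‖ ≤ Cp * E y ^ kp)
    {Cr : ℝ} {kr : ℕ} (hEp : ∀ y ∈ X, E (p y) ≤ Cr * E y ^ kr)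
    {q : ℕ} (β₀ : W → W [⋀^Fin q]→L[ℝ] V) (hβ₀s : DifferentiableOn ℝ β₀ X)
    (hβ₀i : ∀ γ : Γ, ∀ x ∈ X, actAlt ρ (act.comp ι) γ q (β₀ ((act.comp ι) γ⁻¹ x)) = β₀ x)
    {Cb : ℝ} {kb : ℕ} (hb : ∀ w ∈ X, (∃ t ∈ T, act t⁻¹ w ∈ R₀) →
      ‖β₀ w‖ ≤ Cb * E w ^ kb ∧ ‖fderiv ℝ β₀ w‖ ≤ Cb * E w ^ kb) :
    ∃ (C : ℝ) (k : ℕ), ∀ y ∈ X, act g y ∈ R₁ →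
      ‖(β₀ (p y)).compContinuousLinearMap (fderiv ℝ p y)‖ ≤ C * E y ^ k ∧
      ‖fderiv ℝ (fun x => (β₀ (p x)).compContinuousLinearMap (fderiv ℝ p x)) y‖ ≤ C * E y ^ k := by
  classical
  have hmapsΓ : ∀ γ : Γ, MapsTo ((act.comp ι) γ) X X := fun γ => hX (ι γ)
  have haΓ : ∀ γ : Γ, (act.comp ι) γ⁻¹ = act (ι γ)⁻¹ := fun γ => by rw [MonoidHom.comp_apply, map_inv]
  choose d hd0 hd using hEact
  /- the finitely many `γ ∈ Γ` moving some `t · R'`, `t ∈ T`, onto `g⁻¹ · R'` -/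
  have hfin' : Set.Finite {γ : Γ | ∃ t ∈ T, ∃ H ∈ X, act (ι γ * t)⁻¹ H ∈ R' ∧ act g H ∈ R'} := by
    refine (Set.Finite.biUnion T.finite_toSet hfin).subset ?_
    rintro γ ⟨t, ht, H, hH, hr1, hr2⟩
    exact Set.mem_iUnion₂.2 ⟨t, ht, H, hH, hr1, hr2⟩
  /- uniform constants over this finite set -/
  obtain ⟨B₀, hB₀⟩ := (hfin'.image fun γ : Γ =>
    (1 + ‖ρCLM ρ γ‖) * (1 + ‖(act.comp ι) γ⁻¹‖) ^ (q + 1) * d (ι γ)⁻¹ ^ kb).bddAbove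
  obtain ⟨B, hB⟩ : ∃ B : ℝ, B = max B₀ 1 := ⟨_, rfl⟩
  have hB1 : 1 ≤ B := by rw [hB]; exact le_max_right _ _
  have hB0 : 0 ≤ B := zero_le_one.trans hB1
  have hB0' : B₀ ≤ B := by rw [hB]; exact le_max_left _ _
  /- the master constant -/
  have hT1 : 0 ≤ |Cp| := abs_nonneg _
  have hT2 : 0 ≤ B * |Cb| * |Cr| ^ kb := mul_nonneg (mul_nonneg hB0 (abs_nonneg _)) (pow_nonneg (abs_nonneg _) _)
  obtain ⟨A, hA⟩ : ∃ A : ℝ, A = 1 + |Cp| + B * |Cb| * |Cr| ^ kb := ⟨_, rfl⟩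
  have hA2 : |Cp| ≤ A := by rw [hA]; linarith only [hT1, hT2]
  have hA3 : B * |Cb| * |Cr| ^ kb ≤ A := by rw [hA]; linarith only [hT1, hT2]
  have hA1 : 1 ≤ A := by rw [hA]; linarith only [hT1, hT2]
  have hA0 : 0 ≤ A := zero_le_one.trans hA1
  obtain ⟨m, hm⟩ : ∃ m : ℕ, m = kp + kr * kb := ⟨_, rfl⟩
  have hm1 : kp ≤ m := by rw [hm]; exact Nat.le_add_right _ _
  have hm2 : kr * kb ≤ m := by rw [hm]; exact Nat.le_add_left _ _
  have hq0 : (0 : ℝ) ≤ q := Nat.cast_nonneg q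
  refine ⟨(1 + q) * A ^ (q + 2), m * (q + 2), fun y hy hyred => ?_⟩
  /- the point `y` and the derivative bounds of `p` at `y` -/
  have hEy1 : 1 ≤ E y := hE1 y
  have hEy0 : 0 ≤ E y := zero_le_one.trans hEy1
  have hEm1 : ∀ {a b : ℕ}, a ≤ b → E y ^ a ≤ E y ^ b := fun h => pow_le_pow_right₀ hEy1 h
  obtain ⟨hDp1, hD2p⟩ := hDp y hy
  obtain ⟨M, hM⟩ : ∃ M : ℝ, M = A * E y ^ m := ⟨_, rfl⟩
  have hM1 : 1 ≤ M := by rw [hM]; exact one_le_mul_of_one_le_of_one_le hA1 (one_le_pow₀ hEy1)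
  have hM0 : 0 ≤ M := zero_le_one.trans hM1
  have hpM : ∀ {u : ℝ}, u ≤ Cp * E y ^ kp → u ≤ M := fun {u} hu => by
    calc u ≤ Cp * E y ^ kp := hu
      _ ≤ |Cp| * E y ^ kp := mul_le_mul_of_nonneg_right (le_abs_self _) (pow_nonneg hEy0 _)
      _ ≤ A * E y ^ m := mul_le_mul hA2 (hEm1 hm1) (pow_nonneg hEy0 _) hA0
      _ = M := hM.symm
  have hDpM : ‖fderiv ℝ p y‖ ≤ M := hpM hDp1
  have hD2pM : ‖fderiv ℝ (fderiv ℝ p) y‖ ≤ M := hpM hD2p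
  /- the point `z = p y`, the cover, the finite set -/
  have hz : p y ∈ X := hpX y hy
  obtain ⟨γ, t, ht, hred⟩ := hcov (p y) hz
  obtain ⟨r, hr, hpy⟩ := hpr y hy
  have hred' : act (ι γ * t)⁻¹ y ∈ R₀ := by
    rw [hpy, map_smul] at hred
    exact hR₀ r hr _ hred
  have hγS : γ ∈ {γ : Γ | ∃ t ∈ T, ∃ H ∈ X, act (ι γ * t)⁻¹ H ∈ R' ∧ act g H ∈ R'} :=
    ⟨t, ht, y, hy, h₀ hred', h₁ hyred⟩
  -- the constants of `γ`
  have hR₁0 : 0 ≤ ‖ρCLM ρ γ‖ := norm_nonneg _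
  have hR₂0 : 0 ≤ ‖(act.comp ι) γ⁻¹‖ := norm_nonneg _
  have hR₃0 : 0 ≤ d (ι γ)⁻¹ := hd0 _
  have hRm0 : 0 ≤ (1 + ‖ρCLM ρ γ‖) * (1 + ‖(act.comp ι) γ⁻¹‖) ^ (q + 1) :=
    mul_nonneg (add_nonneg zero_le_one hR₁0) (pow_nonneg (add_nonneg zero_le_one hR₂0) _)
  have hΦ : (1 + ‖ρCLM ρ γ‖) * (1 + ‖(act.comp ι) γ⁻¹‖) ^ (q + 1) * d (ι γ)⁻¹ ^ kb ≤ B :=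
    (hB₀ (Set.mem_image_of_mem _ hγS)).trans hB0'
  /- the point `w = γ⁻¹ · z` lies in the fundamental set -/
  have hwX : (act.comp ι) γ⁻¹ (p y) ∈ X := hmapsΓ γ⁻¹ hz
  have hw : ∃ t ∈ T, act t⁻¹ ((act.comp ι) γ⁻¹ (p y)) ∈ R₀ := by
    refine ⟨t, ht, ?_⟩
    rw [mul_inv_rev, map_mul, mul_apply_eq_comp] at hred
    rw [haΓ]
    exact hred
  obtain ⟨hb1, hb2⟩ := hb _ hwX hw
  /- gauges: `E(w) ≤ d E(z) ≤ d Cr E^kr` -/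
  have hEw1 : 1 ≤ E ((act.comp ι) γ⁻¹ (p y)) := hE1 _
  have hEw0 : 0 ≤ E ((act.comp ι) γ⁻¹ (p y)) := zero_le_one.trans hEw1
  have hEzle : E (p y) ≤ Cr * E y ^ kr := hEp y hy
  have hEwle : E ((act.comp ι) γ⁻¹ (p y)) ≤ d (ι γ)⁻¹ * E (p y) := by
    rw [haΓ]
    exact hd _ _
  have hCr1 : Cr * E y ^ kr ≤ |Cr| * E y ^ kr := mul_le_mul_of_nonneg_right (le_abs_self _) (pow_nonneg hEy0 _)
  have hEwkb : E ((act.comp ι) γ⁻¹ (p y)) ^ kb ≤ d (ι γ)⁻¹ ^ kb * |Cr| ^ kb * E y ^ (kr * kb) := by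
    calc E ((act.comp ι) γ⁻¹ (p y)) ^ kb ≤ (d (ι γ)⁻¹ * (|Cr| * E y ^ kr)) ^ kb :=
          pow_le_pow_left₀ hEw0 (hEwle.trans (mul_le_mul_of_nonneg_left (hEzle.trans hCr1) hR₃0)) kb
      _ = _ := by rw [mul_pow, mul_pow, ← pow_mul]; ring
  /- invariance: `β₀ z` and `Dβ₀ z` through `β₀ w`, `Dβ₀ w` -/
  have hβw : DifferentiableAt ℝ β₀ ((act.comp ι) γ⁻¹ (p y)) :=
    (hβ₀s _ hwX).differentiableAt (hXo.mem_nhds hwX)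
  have hn1 : ‖β₀ (p y)‖ ≤ ‖ρCLM ρ γ‖ * ‖(act.comp ι) γ⁻¹‖ ^ q * ‖β₀ ((act.comp ι) γ⁻¹ (p y))‖ :=
    norm_le_of_invariant ρ (act.comp ι) (hβ₀i γ (p y) hz)
  have hn2 : ‖fderiv ℝ β₀ (p y)‖ ≤
      ‖ρCLM ρ γ‖ * ‖(act.comp ι) γ⁻¹‖ ^ (q + 1) * ‖fderiv ℝ β₀ ((act.comp ι) γ⁻¹ (p y))‖ :=
    norm_fderiv_le_of_invariant ρ (act.comp ι) hXo (hβ₀i γ) hz hβw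
  have hCb : ∀ {u : ℝ}, u ≤ Cb * E ((act.comp ι) γ⁻¹ (p y)) ^ kb →
      u ≤ |Cb| * E ((act.comp ι) γ⁻¹ (p y)) ^ kb := fun h =>
    h.trans (mul_le_mul_of_nonneg_right (le_abs_self _) (pow_nonneg hEw0 _))
  have hb1' := hCb hb1
  have hb2' := hCb hb2
  -- `R₁ R₂^q, R₁ R₂^{q+1} ≤ (1 + R₁)(1 + R₂)^{q+1}`
  have h1R₁ : ‖ρCLM ρ γ‖ ≤ 1 + ‖ρCLM ρ γ‖ := le_add_of_nonneg_left zero_le_one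
  have h1R₂ : ‖(act.comp ι) γ⁻¹‖ ≤ 1 + ‖(act.comp ι) γ⁻¹‖ := le_add_of_nonneg_left zero_le_one
  have h1R₂' : (1 : ℝ) ≤ 1 + ‖(act.comp ι) γ⁻¹‖ := le_add_of_nonneg_right hR₂0
  have hR12 : ‖ρCLM ρ γ‖ * ‖(act.comp ι) γ⁻¹‖ ^ (q + 1) ≤
      (1 + ‖ρCLM ρ γ‖) * (1 + ‖(act.comp ι) γ⁻¹‖) ^ (q + 1) :=
    mul_le_mul h1R₁ (pow_le_pow_left₀ hR₂0 h1R₂ _) (pow_nonneg hR₂0 _) (add_nonneg zero_le_one hR₁0)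
  have hR12' : ‖ρCLM ρ γ‖ * ‖(act.comp ι) γ⁻¹‖ ^ q ≤
      (1 + ‖ρCLM ρ γ‖) * (1 + ‖(act.comp ι) γ⁻¹‖) ^ (q + 1) :=
    mul_le_mul h1R₁ ((pow_le_pow_left₀ hR₂0 h1R₂ _).trans (pow_le_pow_right₀ h1R₂' (Nat.le_succ q)))
      (pow_nonneg hR₂0 _) (add_nonneg zero_le_one hR₁0)
  have key : ∀ {u R : ℝ}, R ≤ (1 + ‖ρCLM ρ γ‖) * (1 + ‖(act.comp ι) γ⁻¹‖) ^ (q + 1) →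
      u ≤ R * (|Cb| * E ((act.comp ι) γ⁻¹ (p y)) ^ kb) → u ≤ M := by
    intro u R hR hu
    calc u ≤ R * (|Cb| * E ((act.comp ι) γ⁻¹ (p y)) ^ kb) := hu
      _ ≤ ((1 + ‖ρCLM ρ γ‖) * (1 + ‖(act.comp ι) γ⁻¹‖) ^ (q + 1)) *
          (|Cb| * (d (ι γ)⁻¹ ^ kb * |Cr| ^ kb * E y ^ (kr * kb))) :=
          mul_le_mul hR (mul_le_mul_of_nonneg_left hEwkb (abs_nonneg _))
            (mul_nonneg (abs_nonneg _) (pow_nonneg hEw0 _)) hRm0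
      _ = ((1 + ‖ρCLM ρ γ‖) * (1 + ‖(act.comp ι) γ⁻¹‖) ^ (q + 1) * d (ι γ)⁻¹ ^ kb) *
          |Cb| * |Cr| ^ kb * E y ^ (kr * kb) := by ring
      _ ≤ B * |Cb| * |Cr| ^ kb * E y ^ (kr * kb) :=
          mul_le_mul_of_nonneg_right (mul_le_mul_of_nonneg_right
            (mul_le_mul_of_nonneg_right hΦ (abs_nonneg _)) (pow_nonneg (abs_nonneg _) _)) (pow_nonneg hEy0 _)
      _ ≤ A * E y ^ m := mul_le_mul hA3 (hEm1 hm2) (pow_nonneg hEy0 _) hA0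
      _ = M := hM.symm
  have hβzM : ‖β₀ (p y)‖ ≤ M :=
    key hR12' (hn1.trans (mul_le_mul_of_nonneg_left hb1' (mul_nonneg hR₁0 (pow_nonneg hR₂0 _))))
  have hDβzM : ‖fderiv ℝ β₀ (p y)‖ ≤ M :=
    key hR12 (hn2.trans (mul_le_mul_of_nonneg_left hb2' (mul_nonneg hR₁0 (pow_nonneg hR₂0 _))))
  /- assembling -/
  have hMq : M ^ (q + 2) = A ^ (q + 2) * E y ^ (m * (q + 2)) := by rw [hM, mul_pow, ← pow_mul]
  have h1q : (1 : ℝ) ≤ 1 + q := le_add_of_nonneg_right hq0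
  have hpy' : DifferentiableAt ℝ p y := (hpd y hy).differentiableAt (hXo.mem_nhds hy)
  have hβz : DifferentiableAt ℝ β₀ (p y) := (hβ₀s _ hz).differentiableAt (hXo.mem_nhds hz)
  have hp2y : DifferentiableAt ℝ (fun x => fderiv ℝ p x) y := (hpd2 y hy).differentiableAt (hXo.mem_nhds hy)
  refine ⟨?_, ?_⟩
  · calc ‖(β₀ (p y)).compContinuousLinearMap (fderiv ℝ p y)‖ ≤ ‖β₀ (p y)‖ * ‖fderiv ℝ p y‖ ^ q := by
          simpa using (β₀ (p y)).norm_compContinuousLinearMap_le (fderiv ℝ p y)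
      _ ≤ M * M ^ q :=
          mul_le_mul hβzM (pow_le_pow_left₀ (norm_nonneg _) hDpM q) (pow_nonneg (norm_nonneg _) q) hM0
      _ = M ^ (q + 1) := by ring
      _ ≤ M ^ (q + 2) := pow_le_pow_right₀ hM1 (Nat.le_succ _)
      _ ≤ (1 + q) * M ^ (q + 2) := le_mul_of_one_le_left (pow_nonneg hM0 _) h1q
      _ = (1 + q) * A ^ (q + 2) * E y ^ (m * (q + 2)) := by rw [hMq, mul_assoc]
  · calc ‖fderiv ℝ (fun x => (β₀ (p x)).compContinuousLinearMap (fderiv ℝ p x)) y‖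
        ≤ (1 + q) * M ^ (q + 2) :=
          Pullback.norm_fderiv_pullback_le hβz hpy' hp2y hM1 hDpM hD2pM hβzM hDβzM
      _ = (1 + q) * A ^ (q + 2) * E y ^ (m * (q + 2)) := by rw [hMq, mul_assoc]

end TwistedQuotient

end Literature.NumberTheory.Automorphic

end
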